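import Mathlib
import HarnessLib
import Summits.ValiantsHypothesis.ValiantsHypothesis.Theses.MonotoneRestoration
import Literature.Computability.AlgebraicComplexity.ArithCircuit
import Literature.Computability.AlgebraicComplexity.ArithCircuitProofs
import Literature.Computability.AlgebraicComplexity.MonotoneStructure
import Literature.Computability.AlgebraicComplexity.PermanentIrreducible
import Literature.ModelTheory.FiniteModelTheory.CkEquiv
import Summits.ValiantsHypothesis.ValiantsHypothesis.Theorems.MonotoneRestorationMonotoneRestorationQPCosetCount
import Summits.ValiantsHypothesis.ValiantsHypothesis.Theorems.MonotoneRestorationMonotoneRestorationQPSymmetricLB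
import Summits.ValiantsHypothesis.ValiantsHypothesis.Theorems.MonotoneRestorationMonotoneRestorationQPSupportSymmetrisation
import Summits.ValiantsHypothesis.ValiantsHypothesis.Theorems.MonotoneRestorationMonotoneRestorationQPSparseRegime
import Summits.ValiantsHypothesis.ValiantsHypothesis.Theorems.MonotoneRestorationMonotoneRestorationQPBeta
import Literature.Computability.AlgebraicComplexity.SymmetricArithCircuit
import Literature.Computability.AlgebraicComplexity.DawarWilsenach2025Proofs
import Literature.GroupTheory.PermutationGroups.SmallIndexSubgroups
import Summits.ValiantsHypothesis.ValiantsHypothesis.Theorems.MonotoneRestorationQP.Negative.LoadBearing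
import Summits.ValiantsHypothesis.ValiantsHypothesis.Theorems.MonotoneRestorationMonotoneRestorationQPPermSupportCount
import Summits.ValiantsHypothesis.ValiantsHypothesis.Theorems.MonotoneRestorationMonotoneRestorationQPEsymmRowSumsStructure

/-! TTRL-lite variant V19151 of stmt-ValiantsHypothesis-15886 -/

-- `Summit.ValiantsHypothesis.ValiantsHypothesis.…` is the tree's mandated single-conjunct layout
-- (Sub = Summit), so the duplicated namespace component is intended.
set_option linter.dupNamespace false

namespace Summit.ValiantsHypothesis.ValiantsHypothesis.Theorems

open Summit.ValiantsHypothesis.ValiantsHypothesis.Theses.MonotoneRestoration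
open Literature.Computability.AlgebraicComplexity

/-- **TTRL-lite variant V19151** (`generalise` of stub `stub_esymmRowSums_structure`,
stmt-ValiantsHypothesis-15886): the elementary symmetric polynomial of degree `⌊n/2⌋` in the
row sums `R_i = Σ_j x_{i,j}` of the `n × n` variable matrix, over `ℝ≥0`, has total degree
exactly `⌊n/2⌋`. This is what the skeleton consumes: `≤` from homogeneity
(`esymmRowSumsStructure_isHomogeneous`), `=` because the polynomial is nonzero
(`esymmRowSumsStructure_ne_zero`, using `⌊n/2⌋ ≤ n`) via
`MvPolynomial.IsHomogeneous.totalDegree`. [folklore] -/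
theorem stub_esymmRowSums_structure_var19151 :
    ∀ (n : ℕ), (MvPolynomial.bind₁ (fun i : Fin n => ∑ j : Fin n, MvPolynomial.X (i, j))
      (MvPolynomial.esymm (Fin n) NNReal (n / 2))).totalDegree = n / 2 :=
  fun n => (esymmRowSumsStructure_isHomogeneous n (n / 2)).totalDegree
    (esymmRowSumsStructure_ne_zero n (n / 2) (Nat.div_le_self n 2))

end Summit.ValiantsHypothesis.ValiantsHypothesis.Theorems
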